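import Mathlib
import Summits.Ventures.HodgeRepro.LitRankYanai3

/-!
# LitRankYanai — Yanai 1985 Theorem p.171: reduction to the faithful case and the theorem

Blind cell `pub-hodge-repro`, seat lit-2. Part 4 of 4 of the former single file `LitRankYanai.lean` (split at the ≤ 400-line rule, gen 4; text of every declaration unchanged). Imports `LitRankYanai3` (and through it the rest of the chain).
-/

open Finset
open scoped Pointwise

namespace HodgeRepro.Lit2

/-! ## §6  Reduction to the faithful case -/

namespace CMTriple

/-! ### Reduction to the faithful case: the quotient triple `(G/N, H/N, S̃/N)` for `N ⊴ G`, `N ≤ H`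

Yanai p.171 works with `G = Gal(L/ℚ)` acting faithfully on `H\G` (the Galois closure); our
abstract triples need not be faithful, so we quotient by the normal core of `H` first.  Rank,
dimension and simplicity are unchanged. -/

section Quotient

variable {G : Type*} [Group G] [DecidableEq G] (T : CMTriple G)
variable (N : Subgroup G) [N.Normal] (hN : N ≤ T.H) [DecidableEq (G ⧸ N)]

omit [DecidableEq G] in
/-- `S̃` is `N`-saturated: `mk g ∈ mk '' S̃ ↔ g ∈ S̃`. -/
theorem mk_mem_image_mk_iff (hN : N ≤ T.H) (g : G) :
    (g : G ⧸ N) ∈ T.S.image (QuotientGroup.mk : G → G ⧸ N) ↔ g ∈ T.S := by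
  rw [Finset.mem_image]
  constructor
  · rintro ⟨a, ha, hag⟩
    have hn : a⁻¹ * g ∈ N := QuotientGroup.eq.mp hag
    have hn' : a * (a⁻¹ * g) * a⁻¹ ∈ N := ‹N.Normal›.conj_mem _ hn a
    have := T.H_mul_mem _ (hN hn') a ha
    rwa [inv_mul_cancel_right, mul_inv_cancel_left] at this
  · intro hg
    exact ⟨g, hg, rfl⟩

omit [DecidableEq G] in
/-- The quotient triple `(G/N, H/N, S̃/N)`. -/
def quotientTriple : CMTriple (G ⧸ N) where
  H := T.H.map (QuotientGroup.mk' N)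
  ρ := (T.ρ : G ⧸ N)
  ρ_ne_one := by
    intro h
    rw [QuotientGroup.eq_one_iff] at h
    exact T.ρ_notMem_H (hN h)
  ρ_mul_self := by rw [← QuotientGroup.mk_mul, T.ρ_mul_self, QuotientGroup.mk_one]
  ρ_comm := by
    intro q
    induction q using QuotientGroup.induction_on with
    | H g => rw [← QuotientGroup.mk_mul, ← QuotientGroup.mk_mul, T.ρ_comm]
  S := T.S.image (QuotientGroup.mk : G → G ⧸ N)
  H_mul_mem := by
    intro h hh x hx
    obtain ⟨h, hhH, rfl⟩ := Subgroup.mem_map.mp hh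
    rw [Finset.mem_image] at hx
    obtain ⟨x, hx, rfl⟩ := hx
    rw [QuotientGroup.mk'_apply, ← QuotientGroup.mk_mul, T.mk_mem_image_mk_iff N hN]
    exact T.H_mul_mem h hhH x hx
  mem_iff := by
    intro q
    induction q using QuotientGroup.induction_on with
    | H g =>
      rw [T.mk_mem_image_mk_iff N hN, ← QuotientGroup.mk_mul, T.mk_mem_image_mk_iff N hN]
      exact T.mem_iff g

omit [DecidableEq G] in
/-- The quotient triple has `H/N` as its subgroup. -/
theorem quotientTriple_H : (T.quotientTriple N hN).H = T.H.map (QuotientGroup.mk' N) := rfl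

omit [DecidableEq G] in
/-- The quotient triple has `ρ N` as its conjugation. -/
theorem quotientTriple_ρ : (T.quotientTriple N hN).ρ = (T.ρ : G ⧸ N) := rfl

omit [DecidableEq G] in
/-- The quotient triple has `S̃ / N` as its type. -/
theorem quotientTriple_S :
    (T.quotientTriple N hN).S = T.S.image (QuotientGroup.mk : G → G ⧸ N) := rfl

omit [DecidableEq G] in
/-- `g N ∈ S̃/N ↔ g ∈ S̃`. -/
theorem mk_mem_quotientTriple_S_iff (g : G) :
    (g : G ⧸ N) ∈ (T.quotientTriple N hN).S ↔ g ∈ T.S := T.mk_mem_image_mk_iff N hN g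

omit [DecidableEq G] in
/-- `[G/N : H/N] = [G : H]`, hence `dim` is unchanged. -/
theorem quotientTriple_dim : (T.quotientTriple N hN).dim = T.dim := by
  unfold dim
  rw [quotientTriple_H, Subgroup.index_map_eq _ (QuotientGroup.mk'_surjective N)
    (by rw [QuotientGroup.ker_mk']; exact hN)]

/-- Simplicity descends to the quotient triple. -/
theorem quotientTriple_isSimple (hs : T.IsSimple) : (T.quotientTriple N hN).IsSimple := by
  intro q hq
  induction q using QuotientGroup.induction_on with
  | H g =>
    rw [quotientTriple_H, Subgroup.mem_map]
    refine ⟨g, hs g ?_, rfl⟩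
    ext x
    rw [← Finset.inv_smul_mem_iff, ← T.mk_mem_quotientTriple_S_iff N hN,
      ← T.mk_mem_quotientTriple_S_iff N hN, smul_eq_mul, QuotientGroup.mk_mul,
      QuotientGroup.mk_inv, ← smul_eq_mul, Finset.inv_smul_mem_iff, hq]

end Quotient

section QuotientRank

variable {G : Type*} [Group G] [Fintype G] [DecidableEq G] (T : CMTriple G)
variable (N : Subgroup G) [N.Normal] (hN : N ≤ T.H) [Fintype (G ⧸ N)] [DecidableEq (G ⧸ N)]

/-- Pulling back functions along `G → G/N`. -/
noncomputable def pullFun : ((G ⧸ N) → ℚ) →ₗ[ℚ] (G → ℚ) :=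
  LinearMap.funLeft ℚ ℚ (QuotientGroup.mk : G → G ⧸ N)

omit [Fintype G] [DecidableEq G] [N.Normal] [Fintype (G ⧸ N)] [DecidableEq (G ⧸ N)] in
/-- `pullFun N f g = f (g N)`. -/
theorem pullFun_apply (f : (G ⧸ N) → ℚ) (g : G) : pullFun N f g = f (g : G ⧸ N) := rfl

omit [Fintype G] [DecidableEq G] [N.Normal] [Fintype (G ⧸ N)] [DecidableEq (G ⧸ N)] in
/-- Pulling back along the surjection `G → G/N` is injective. -/
theorem pullFun_injective : Function.Injective (pullFun (G := G) N) :=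
  LinearMap.funLeft_injective_of_surjective ℚ ℚ _ (QuotientGroup.mk_surjective)

omit [Fintype G] [Fintype (G ⧸ N)] in
/-- The pullback of the indicator of the right translate `(S̃/N) (gN)` is the indicator of `S̃ g`. -/
theorem pullFun_indFun_image (g : G) :
    pullFun N (indFun ((T.quotientTriple N hN).S.image (· * (g : G ⧸ N)))) =
      indFun (T.S.image (· * g)) := by
  ext x
  simp only [pullFun_apply, indFun]
  congr 1
  rw [(T.quotientTriple N hN).mem_image_mul_right_iff, T.mem_image_mul_right_iff,
    ← QuotientGroup.mk_inv, ← QuotientGroup.mk_mul, T.mk_mem_quotientTriple_S_iff N hN]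

/-- **The rank is unchanged by the quotient** `(G, H, S̃) ↦ (G/N, H/N, S̃/N)`. -/
theorem quotientTriple_rank : (T.quotientTriple N hN).rank = T.rank := by
  rw [T.rank_eq_finrank_span_rightTranslates,
    (T.quotientTriple N hN).rank_eq_finrank_span_rightTranslates]
  set A : Set ((G ⧸ N) → ℚ) :=
    Set.range fun q : G ⧸ N => indFun ((T.quotientTriple N hN).S.image (· * q)) with hA
  have hmap : (Submodule.span ℚ A).map (pullFun N) =
      Submodule.span ℚ (Set.range fun g : G => indFun (T.S.image (· * g))) := by
    rw [Submodule.map_span]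
    congr 1
    rw [hA, ← Set.range_comp, ← (QuotientGroup.mk_surjective (s := N)).range_comp]
    congr 1
    funext g
    exact T.pullFun_indFun_image N hN g
  have hinj : Function.Injective ((pullFun N).domRestrict (Submodule.span ℚ A)) :=
    (pullFun_injective N).comp Subtype.val_injective
  symm
  calc Module.finrank ℚ (Submodule.span ℚ (Set.range fun g : G => indFun (T.S.image (· * g))))
      = Module.finrank ℚ ((Submodule.span ℚ A).map (pullFun N)) := by rw [hmap]
    _ = Module.finrank ℚ (LinearMap.range ((pullFun N).domRestrict (Submodule.span ℚ A))) := by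
        rw [LinearMap.range_domRestrict]
    _ = Module.finrank ℚ (Submodule.span ℚ A) := LinearMap.finrank_range_of_inj hinj

end QuotientRank

/-! ### The quotient by the normal core is faithful -/

variable {G : Type*} [Group G] (T : CMTriple G)

/-- `H/N` has trivial normal core in `G/N` when `N = normalCore H`. -/
theorem normalCore_map_eq_bot :
    (T.H.map (QuotientGroup.mk' T.H.normalCore)).normalCore = ⊥ := by
  set N := T.H.normalCore with hNdef
  set K := (T.H.map (QuotientGroup.mk' N)).normalCore with hKdef
  have hKnormal : K.Normal := Subgroup.normalCore_normal _
  have hK' : (K.comap (QuotientGroup.mk' N)).Normal := hKnormal.comap _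
  have hle : K.comap (QuotientGroup.mk' N) ≤ T.H := by
    calc K.comap (QuotientGroup.mk' N)
        ≤ (T.H.map (QuotientGroup.mk' N)).comap (QuotientGroup.mk' N) :=
          Subgroup.comap_mono (Subgroup.normalCore_le _)
      _ = T.H ⊔ (QuotientGroup.mk' N).ker := Subgroup.comap_map_eq _ _
      _ = T.H := by rw [QuotientGroup.ker_mk']; exact sup_eq_left.mpr (Subgroup.normalCore_le _)
  have hleN : K.comap (QuotientGroup.mk' N) ≤ N :=
    (Subgroup.normal_le_normalCore (N := K.comap (QuotientGroup.mk' N))).mpr hle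
  have hKeq : K = (K.comap (QuotientGroup.mk' N)).map (QuotientGroup.mk' N) :=
    (Subgroup.map_comap_eq_self_of_surjective (QuotientGroup.mk'_surjective N) K).symm
  rw [hKeq, eq_bot_iff]
  calc (K.comap (QuotientGroup.mk' N)).map (QuotientGroup.mk' N)
      ≤ N.map (QuotientGroup.mk' N) := Subgroup.map_mono hleN
    _ = ⊥ := QuotientGroup.map_mk'_self N

end CMTriple

/-! ## §7  Assembly -/

namespace CMTriple

/-! ### Assembly: Yanai's Theorem (Yanai 1985, Theorem p.171; Dodson 1987 Thm 1.0 (v), Ribet) -/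

variable {G : Type} [Group G] [Fintype G] [DecidableEq G] (T : CMTriple G)

/-- **Yanai's Theorem, faithful case** (`normalCore H = 1`): a simple CM-type of prime dimension
`d` is nondegenerate.  `d = 2`: `3 ≤ rank ≤ d + 1 = 3`.  `d` odd: pick `g₀` of order `d` outside
`H` (Cauchy + faithfulness) and split on Yanai's exceptional case `S = ⟨g₀⟩, ⟨g₀⟩ρ`. -/
theorem isNondegenerate_of_isSimple_of_prime_of_core (hK : Kubota_rank_abelian_charFormula)
    (hcore : T.H.normalCore = ⊥) (hs : T.IsSimple) (hd : T.dim.Prime) : T.IsNondegenerate := by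
  classical
  rcases eq_or_ne T.dim 2 with hd2 | hd2
  · have h3 := T.three_le_rank_of_isSimple hs hd.two_le
    have h := T.rank_le_dim_add_one
    unfold IsNondegenerate
    omega
  · obtain ⟨g₀, hg, hgH⟩ := T.exists_orderOf_eq_dim_notMem_H hcore hd
    by_cases hexc : T.Exc g₀
    · exact T.isNondegenerate_of_exc hK hd hd2 hs hg hgH hexc
    · exact T.isNondegenerate_of_not_exc hK hd hd2 hg hgH hexc

/-- **Yanai's Theorem** for every CM triple, conditional on Kubota's character formula: reduce to
the faithful case through the quotient by `normalCore H` (rank, dimension, simplicity are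
unchanged). -/
theorem isNondegenerate_of_isSimple_of_prime (hK : Kubota_rank_abelian_charFormula)
    (hs : T.IsSimple) (hd : T.dim.Prime) : T.IsNondegenerate := by
  classical
  let N := T.H.normalCore
  letI : Fintype (G ⧸ N) := Fintype.ofFinite _
  have hN : N ≤ T.H := Subgroup.normalCore_le _
  have h1 : (T.quotientTriple N hN).IsNondegenerate :=
    (T.quotientTriple N hN).isNondegenerate_of_isSimple_of_prime_of_core hK
      T.normalCore_map_eq_bot (T.quotientTriple_isSimple N hN hs)
      (by rw [T.quotientTriple_dim]; exact hd)
  unfold IsNondegenerate at h1 ⊢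
  rwa [T.quotientTriple_rank, T.quotientTriple_dim] at h1

end CMTriple

/-- **Yanai 1985, Theorem p.171 (store p0003:L24–26), conditional on Kubota's character formula**:
"Let (K,S) be a simple CM-type of dimension d.  If d is a prime, then (K,S) is non-degenerate."
Proof as printed (Yanai p.171–172): Cauchy's theorem gives `g₀` of order `d` outside `H` (after
passing to the faithful quotient `G/normalCore H`); `G₀ = ⟨ρ g₀⟩` is cyclic of order `2d` and a
transversal of `H\G`; the restricted type `(G₀, 1, S ∩ G₀)` is simple unless `S ∩ G₀ ∈ {⟨g₀⟩,
⟨g₀⟩ρ}`, in which case a Galois conjugate `S g` (same rank, Prop. A (b)) is used instead; Yanai's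
Lemma (cyclic case, via Kubota's Lemma 2) gives rank `d + 1` for the restricted type, and Prop. B
(Tankeev) with Prop. A (c) give `d + 1 ≤ rank(K,S) ≤ d + 1`.  The case `d = 2` is `3 ≤ rank ≤ 3`. -/
theorem Yanai1985_theorem_prime_nondegenerate_of_charFormula
    (hK : Kubota_rank_abelian_charFormula) : Yanai1985_theorem_prime_nondegenerate :=
  fun _G _ _ _ T hs hd => T.isNondegenerate_of_isSimple_of_prime hK hs hd

end HodgeRepro.Lit2
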